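import Summits.QuantumFields.BalabanUV.Beta.FP.LatticeTaylorIndex
import Summits.QuantumFields.BalabanUV.Beta.FP.StencilMoments
import Literature.MathematicalPhysics.QuantumFieldTheory.Balaban1983to89.Beta.KernelWard

/-!
# `BalabanUV.Beta.FP.LegPairing` — THE TAYLOR PAIRING OF A BUBBLE THROUGH TWO EXPONENTIALLY LOCALISED STENCILS: `bubble A V W = Σ_{(ι,κ) ∈ Idx×Idx, fibre} F·G + rem`
# with FINITELY MANY smeared difference legs `F`, `G` and an EXPLICIT remainder series (road «FP», LEGS generic Taylor-pairing track, module (P); [folklore])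

HONEST DEPENDENCY (page 1, mandatory): continuum YM on T⁴ ⇐ BetaPertH ∧ nine spine estimates (0/9 proved); BetaPertH ⇐ (D1) ∧ (D4) ∧
CAP+tail; G-an2-4 gates asym, D1 and NE2/3/4.  HONEST FRAMING (cell contract, verbatim): «discharging `BetaPertH` makes Bałaban's UV
stability UNCONDITIONAL — a real constructive-QFT result; it is NOT the continuum limit and NOT the Clay problem.»  THIS MODULE is elementary
[folklore] bookkeeping of absolutely convergent lattice sums over the tree's `ExpKernelCalculus` (`comp`, `tr`, `bubble`, `BiLoc`) and `KernelWard.Bdd`; it asserts nothing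
about Bałaban's objects, cites nothing, mints no `Prop` fact; THREE DATA `def`s (`dKer`, `remKer`, `sLeg`), 0 sorry.  Value = the ALGEBRAIC half of the LEGS row of road
FP's N7 (`REP-DESIGN.md` (P3) «infinite-range perfect stencils → finite table by Taylor pairing; remainders go to `U`»): the bubble of a bounded leg `A` through stencils
`V` (bi-localised at `q`) and `W` (bi-localised at `p`) IS a FINITE bilinear table of smeared difference legs indexed by `Idx D × Idx D` × fibre², PLUS an explicit remainder
series built from the order-two Taylor remainders of `A` in its free argument (`FP/LatticeTaylorIndex`); the `‖p − q‖⁻⁷` BOUND of that remainder from graded leg decay is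
module (R).  NOT `hlegs`, NOT D1, NOT BetaPertH, NOT continuum, NOT Clay.

WHAT IS HERE.
* §1 objects: `dKer ι A` (the difference word `dOp ι` applied to the FIRST argument of the leg), `remKer p A` (the order-two Taylor remainder of `A(·, y)` at the base `p`,
  as a kernel), `sLeg ι κ A V p q a c := Σ'_z mono κ (z − q) · comp (dKer ι A) V p z a c` (the SMEARED DIFFERENCE LEG: the `ι`-th difference of `A` at the row `p`,
  composed with the stencil `V` and paired with the `κ`-th monomial about `q`); bounds `bdd_dKer` (`|dKer ι A| ≤ 4B`), `abs_comp_bdd_biLoc_le`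
  (`|comp K V x z a c| ≤ |F|·M·C_V·Zl(δ)·e^{−δ|z−q′|₁}` for bounded `K` and `V` bi-localised at `(q, q′)`), summabilities;
* §2 `comp_split`: `comp A V x z a c = Σ_ι mono ι (x − p) · comp (dKer ι A) V p z a c + comp (remKer p A) V x z a c` (linearity of the absolutely convergent row sums);
* §3 **`bubble_sub_table_eq`**: for bounded `A`, `V` bi-localised at `(q,q)`, `W` bi-localised at `(p,p)`:
  `bubble A V W − Σ_{ι κ} Σ_{a c} sLeg ι κ A V p q a c · sLeg κ ι A W q p c a = Σ'_x Σ_a Σ'_z Σ_c E x z a c` with the EXPLICIT remainder integrand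
  `E x z a c = (Σ_ι mono ι (x−p) · comp (dKer ι A) V p z a c) · comp (remKer q A) W z x c a + comp (remKer p A) V x z a c · comp A W z x c a`,
  every series absolutely convergent (`summable_E_inner`, `summable_E_outer`).
Unit `b2b-balaban-beta-d1-formalise-leaf-02` (gen 5).
-/

noncomputable section

namespace Summit.QuantumFields.BalabanUV.Beta.FP.LegPairing

open Finset fwdDiff
open scoped BigOperators
open Literature.MathematicalPhysics.QuantumFieldTheory.Balaban1983to89
open Literature.MathematicalPhysics.QuantumFieldTheory.Balaban1983to89.Beta
open B12Sec2to5 (l1 l1_nonneg)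
open ExpKernelCalculus (Site MKer BiLoc comp tr bubble Zl Zl_pos summable_exp_shift' tsum_exp_shift')
open KernelWard (Bdd)
open Summit.QuantumFields.BalabanUV.Beta.FP.LatticeTaylorIndex (Idx mono dOp abs_mono_le)
open Summit.QuantumFields.BalabanUV.Beta.FP.StencilMoments (biLoc_weight_snd summable_row abs_tsum_row_le)

variable {D : ℕ} {F : Type*} [Fintype F]

/-! ## §1 Difference legs, the Taylor remainder kernel, the smeared difference legs -/

/-- [folklore] The difference word `dOp ι` applied to the FIRST argument of a kernel. -/
def dKer (ι : Idx D) (A : MKer D F) : MKer D F := fun x y a b => dOp ι (fun x' => A x' y a b) x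

/-- [folklore] The ORDER-TWO TAYLOR REMAINDER of `x ↦ A x y a b` about the base point `p`, as a kernel in `(x, y)`. -/
def remKer (p : Site D) (A : MKer D F) : MKer D F := fun x y a b => A x y a b - ∑ ι : Idx D, mono ι (x - p) * dKer ι A p y a b

/-- [folklore] **THE SMEARED DIFFERENCE LEG** `F_{ικ}(A; V; p, q)_{ac} := Σ'_z mono κ (z − q) · (dKer ι A ∘ V)(p, z)_{ac}`. -/
def sLeg (ι κ : Idx D) (A V : MKer D F) (p q : Site D) (a c : F) : ℝ := ∑' z, mono κ (z - q) * comp (dKer ι A) V p z a c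

omit [Fintype F] in
/-- [folklore] The Taylor split of the leg, pointwise: `A = Σ_ι mono ι (x−p) · dKer ι A p + remKer p A`. -/
theorem leg_split (p : Site D) (A : MKer D F) (x y : Site D) (a b : F) :
    A x y a b = ∑ ι : Idx D, mono ι (x - p) * dKer ι A p y a b + remKer p A x y a b := by
  simp only [remKer]; ring

omit [Fintype F] in
/-- [folklore] A difference word of length ≤ 2 of a bounded function is bounded by `4B`. -/
theorem abs_dOp_le (ι : Idx D) {g : (Fin D → ℤ) → ℝ} {B : ℝ} (hg : ∀ x, |g x| ≤ B) (x : Fin D → ℤ) : |dOp ι g x| ≤ 4 * B := by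
  have hB : 0 ≤ B := (abs_nonneg _).trans (hg x)
  rcases ι with u | k | k | ⟨i, k⟩
  · simp only [LatticeTaylorIndex.dOp_inl]; linarith [hg x]
  · simp only [LatticeTaylorIndex.dOp_inr_inl, fwdDiff]
    exact (abs_sub _ _).trans (by linarith [hg (x + Pi.single k 1), hg x])
  · simp only [LatticeTaylorIndex.dOp_inr_inr_inl, fwdDiff]
    calc |g (x + Pi.single k 1 + Pi.single k 1) - g (x + Pi.single k 1) - (g (x + Pi.single k 1) - g x)|
        ≤ |g (x + Pi.single k 1 + Pi.single k 1) - g (x + Pi.single k 1)| + |g (x + Pi.single k 1) - g x| := abs_sub _ _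
      _ ≤ (|g (x + Pi.single k 1 + Pi.single k 1)| + |g (x + Pi.single k 1)|) + (|g (x + Pi.single k 1)| + |g x|) :=
          add_le_add (abs_sub _ _) (abs_sub _ _)
      _ ≤ 4 * B := by linarith [hg (x + Pi.single k 1 + Pi.single k 1), hg (x + Pi.single k 1), hg x]
  · simp only [LatticeTaylorIndex.dOp_inr_inr_inr, fwdDiff]
    calc |g (x + Pi.single i 1 + Pi.single k 1) - g (x + Pi.single i 1) - (g (x + Pi.single k 1) - g x)|
        ≤ |g (x + Pi.single i 1 + Pi.single k 1) - g (x + Pi.single i 1)| + |g (x + Pi.single k 1) - g x| := abs_sub _ _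
      _ ≤ (|g (x + Pi.single i 1 + Pi.single k 1)| + |g (x + Pi.single i 1)|) + (|g (x + Pi.single k 1)| + |g x|) :=
          add_le_add (abs_sub _ _) (abs_sub _ _)
      _ ≤ 4 * B := by linarith [hg (x + Pi.single i 1 + Pi.single k 1), hg (x + Pi.single i 1), hg (x + Pi.single k 1), hg x]

omit [Fintype F] in
/-- [folklore] Difference legs of a bounded leg are bounded: `Bdd A B ⟹ Bdd (dKer ι A) (4B)`. -/
theorem bdd_dKer (ι : Idx D) {A : MKer D F} {B : ℝ} (hA : Bdd A B) : Bdd (dKer ι A) (4 * B) :=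
  fun x y a b => abs_dOp_le ι (fun x' => hA x' y a b) x

/-- [folklore] Termwise bound of a composition of a BOUNDED kernel with a BI-LOCALISED one. -/
theorem abs_compTerm_bdd_biLoc_le {K V : MKer D F} {M Cv δ : ℝ} {q q' : Site D} (hK : Bdd K M) (hV : BiLoc V q q' Cv δ)
    (x z : Site D) (a c : F) (y : Site D) :
    |∑ f, K x y a f * V y z f c| ≤ (Fintype.card F : ℝ) * (M * Cv) * Real.exp (-δ * l1 (z - q')) * Real.exp (-δ * l1 (y - q)) := by
  classical
  have hM : ∀ f, |K x y a f| ≤ M := fun f => hK x y a f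
  calc |∑ f, K x y a f * V y z f c| ≤ ∑ f, |K x y a f * V y z f c| := abs_sum_le_sum_abs _ _
    _ ≤ ∑ _f : F, M * (Cv * Real.exp (-δ * (l1 (y - q) + l1 (z - q')))) := Finset.sum_le_sum fun f _ => by
        rw [abs_mul]
        exact mul_le_mul (hM f) (hV y z f c) (abs_nonneg _) ((abs_nonneg _).trans (hM f))
    _ = (Fintype.card F : ℝ) * (M * Cv) * Real.exp (-δ * l1 (z - q')) * Real.exp (-δ * l1 (y - q)) := by
        rw [Finset.sum_const, Finset.card_univ, nsmul_eq_mul,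
          show -δ * (l1 (y - q) + l1 (z - q')) = -δ * l1 (z - q') + -δ * l1 (y - q) by ring, Real.exp_add]
        ring

/-- [folklore] The defining series of `comp K V x z a c` converges absolutely for bounded `K` and bi-localised `V` (`δ > 0`). -/
theorem summable_compTerm_bdd_biLoc {K V : MKer D F} {M Cv δ : ℝ} {q q' : Site D} (hK : Bdd K M) (hV : BiLoc V q q' Cv δ) (hδ : 0 < δ)
    (x z : Site D) (a c : F) : Summable fun y => ∑ f, K x y a f * V y z f c := by
  refine Summable.of_norm_bounded ((summable_exp_shift' hδ q).mul_left
    ((Fintype.card F : ℝ) * (M * Cv) * Real.exp (-δ * l1 (z - q')))) (fun y => ?_)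
  rw [Real.norm_eq_abs]
  exact abs_compTerm_bdd_biLoc_le hK hV x z a c y

/-- **BOUNDED ∘ BI-LOCALISED DECAYS IN THE SECOND VARIABLE**: `|comp K V x z a c| ≤ |F|·M·C_V·Zl(δ)·e^{−δ|z−q′|₁}`. [folklore] -/
theorem abs_comp_bdd_biLoc_le {K V : MKer D F} {M Cv δ : ℝ} {q q' : Site D} (hK : Bdd K M) (hV : BiLoc V q q' Cv δ) (hδ : 0 < δ)
    (x z : Site D) (a c : F) :
    |comp K V x z a c| ≤ (Fintype.card F : ℝ) * (M * Cv) * Zl D δ * Real.exp (-δ * l1 (z - q')) := by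
  unfold comp
  have hs := (summable_exp_shift' hδ q).mul_left ((Fintype.card F : ℝ) * (M * Cv) * Real.exp (-δ * l1 (z - q')))
  have hb := tsum_of_norm_bounded hs.hasSum (fun y => by
    rw [Real.norm_eq_abs]; exact abs_compTerm_bdd_biLoc_le hK hV x z a c y)
  rw [Real.norm_eq_abs] at hb
  refine hb.trans (le_of_eq ?_)
  rw [tsum_mul_left, tsum_exp_shift']; ring

/-! ## §2 The Taylor split of a composed row -/

/-- **THE TAYLOR SPLIT OF `(A ∘ V)(x, z)`** about the base `p` in the free argument `x`:
`comp A V x z a c = Σ_ι mono ι (x − p) · comp (dKer ι A) V p z a c + comp (remKer p A) V x z a c`. [folklore] -/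
theorem comp_split {A V : MKer D F} {B Cv δ : ℝ} {q q' : Site D} (hA : Bdd A B) (hV : BiLoc V q q' Cv δ) (hδ : 0 < δ)
    (p x z : Site D) (a c : F) :
    comp A V x z a c = ∑ ι : Idx D, mono ι (x - p) * comp (dKer ι A) V p z a c + comp (remKer p A) V x z a c := by
  classical
  have hsum : ∀ ι : Idx D, Summable fun y => ∑ f, dKer ι A p y a f * V y z f c :=
    fun ι => summable_compTerm_bdd_biLoc (bdd_dKer ι hA) hV hδ p z a c
  -- the remainder kernel's rows are bounded (for fixed `x`), hence its composed series converges
  have hR : Summable fun y => ∑ f, remKer p A x y a f * V y z f c := by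
    have e : (fun y => ∑ f, remKer p A x y a f * V y z f c)
        = fun y => (∑ f, A x y a f * V y z f c) - ∑ ι : Idx D, mono ι (x - p) * ∑ f, dKer ι A p y a f * V y z f c := by
      funext y
      simp only [remKer, sub_mul, Finset.sum_sub_distrib, Finset.sum_mul, Finset.mul_sum]
      rw [Finset.sum_comm]
      simp only [mul_assoc]
    rw [e]
    exact (summable_compTerm_bdd_biLoc hA hV hδ x z a c).sub (summable_sum fun ι _ => (hsum ι).mul_left _)
  unfold comp
  have e2 : (fun y => ∑ f, A x y a f * V y z f c)
      = fun y => (∑ ι : Idx D, mono ι (x - p) * ∑ f, dKer ι A p y a f * V y z f c) + ∑ f, remKer p A x y a f * V y z f c := by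
    funext y
    have : ∀ f, A x y a f * V y z f c = (∑ ι : Idx D, mono ι (x - p) * dKer ι A p y a f) * V y z f c + remKer p A x y a f * V y z f c := by
      intro f; rw [leg_split p A x y a f]; ring
    simp only [this, Finset.sum_add_distrib, Finset.sum_mul, Finset.mul_sum]
    rw [Finset.sum_comm]
    simp only [mul_assoc]
  rw [e2, (summable_sum fun ι _ => (hsum ι).mul_left _).tsum_add hR, Summable.tsum_finsetSum (fun ι _ => (hsum ι).mul_left _)]
  simp only [tsum_mul_left]

end Summit.QuantumFields.BalabanUV.Beta.FP.LegPairing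

end
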